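import Mathlib.NumberTheory.EulerProduct.Basic
import Mathlib.NumberTheory.ZetaValues
import Mathlib.NumberTheory.ArithmeticFunction.Moebius
import Mathlib.Data.Int.CardIntervalMod
import HarnessLib

/-!
# Counting in residue classes and the Euler product `Σ_{(d,L)=1} μ(d)/d² = (6/π²) Π_{p ∣ L} (1 - p⁻²)⁻¹`

Elementary inputs for counting squarefree integers (and fundamental discriminants) in arithmetic
progressions (`ThreeTorsionMeanSquarefreeCount.lean`, `ThreeTorsionMeanProofs.lean`), which is the
`Σ 1` part of the Davenport–Heilbronn / Taniguchi–Thorne decomposition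
`Σ_{D ≡ a (m)} #Cl₃(D) = Σ_{D ≡ a (m)} 1 + 2 · #{nowhere totally ramified cubic fields}`
(Taniguchi–Thorne 2013, §6.1 and eq. (6.1); Lemma 21). Everything here is folklore and PROVED:

* `exists_modEq_and_modEq` — the Chinese remainder theorem in `ℤ` (existence) for coprime moduli;
* `abs_card_Ico_filter_modEq_sub_le` — `|#{x ∈ [a, b) : x ≡ v (r)} - (b - a)/r| ≤ 1`;
* `hasProd_one_sub_one_div_prime_sq` — `Π_p (1 - p⁻²) = 6/π²`;
* `hasSum_moebius_coprime_div_sq` — `Σ_{d ≥ 1, (d, L) = 1} μ(d)/d² = (6/π²) Π_{p ∣ L} (1 - p⁻²)⁻¹`.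

## References
* T. Taniguchi, F. Thorne, *Secondary terms in counting functions for cubic fields*, Duke Math. J.
  162 (2013), §6.1, Lemma 21 [TaniguchiThorne2013].
* G. Tenenbaum, *Introduction to analytic and probabilistic number theory*, I.3.7.
-/

noncomputable section

open Finset Filter
open scoped ArithmeticFunction.Moebius Topology

namespace Literature.NumberTheory.QuadraticFields

/-! ### Chinese remainder theorem in `ℤ` (existence) -/

/-- **CRT, existence**: for coprime integers `m`, `n` and any `u`, `v` there is `c` with
`c ≡ u (mod m)` and `c ≡ v (mod n)`. [folklore] -/
theorem exists_modEq_and_modEq {m n : ℤ} (h : IsCoprime m n) (u v : ℤ) :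
    ∃ c : ℤ, c ≡ u [ZMOD m] ∧ c ≡ v [ZMOD n] := by
  obtain ⟨x, y, hxy⟩ := h
  refine ⟨v * x * m + u * y * n, ?_, ?_⟩
  · refine (Int.modEq_iff_dvd.2 ⟨u * x - v * x, ?_⟩)
    linear_combination (-u) * hxy
  · refine (Int.modEq_iff_dvd.2 ⟨v * y - u * y, ?_⟩)
    linear_combination (-v) * hxy

/-- CRT with natural-number coprimality of the moduli. [folklore] -/
theorem exists_modEq_and_modEq_of_coprime {m n : ℕ} (h : m.Coprime n) (u v : ℤ) :
    ∃ c : ℤ, c ≡ u [ZMOD m] ∧ c ≡ v [ZMOD n] :=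
  exists_modEq_and_modEq (Int.isCoprime_iff_gcd_eq_one.2 (by simpa using h)) u v

/-! ### Counting a residue class in an interval -/

/-- **Counting a residue class**: for `r > 0`, `a ≤ b`, the number of `x ∈ [a, b)` with
`x ≡ v (mod r)` differs from `(b - a)/r` by at most `1` (rational form). [folklore] -/
theorem abs_card_Ico_filter_modEq_sub_le_rat {a b : ℤ} (hab : a ≤ b) {r : ℤ} (hr : 0 < r)
    (v : ℤ) :
    |(((Ico a b).filter (fun x => x ≡ v [ZMOD r])).card : ℚ) - ((b : ℚ) - a) / r| ≤ 1 := by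
  have h := Int.Ico_filter_modEq_card a b hr v
  have hr' : (0 : ℚ) < r := by exact_mod_cast hr
  have hmono : ⌈((a : ℚ) - v) / r⌉ ≤ ⌈((b : ℚ) - v) / r⌉ :=
    Int.ceil_mono (div_le_div_of_nonneg_right (by exact_mod_cast sub_le_sub_right hab v) hr'.le)
  rw [max_eq_left (sub_nonneg.2 hmono)] at h
  have hcast : (((Ico a b).filter (fun x => x ≡ v [ZMOD r])).card : ℚ) =
      ((⌈((b : ℚ) - v) / r⌉ - ⌈((a : ℚ) - v) / r⌉ : ℤ) : ℚ) := by
    exact_mod_cast h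
  rw [hcast]
  push_cast
  have h1 := Int.le_ceil (((b : ℚ) - v) / r)
  have h2 := Int.ceil_lt_add_one (((b : ℚ) - v) / r)
  have h3 := Int.le_ceil (((a : ℚ) - v) / r)
  have h4 := Int.ceil_lt_add_one (((a : ℚ) - v) / r)
  have hba : ((b : ℚ) - a) / r = ((b : ℚ) - v) / r - ((a : ℚ) - v) / r := by
    field_simp; ring
  rw [hba, abs_le]
  constructor <;> linarith

/-- **Counting a residue class** (real form): for `r > 0`, `a ≤ b`,
`|#{x ∈ [a, b) : x ≡ v (mod r)} - (b - a)/r| ≤ 1`. [folklore] -/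
theorem abs_card_Ico_filter_modEq_sub_le {a b : ℤ} (hab : a ≤ b) {r : ℤ} (hr : 0 < r) (v : ℤ) :
    |(((Ico a b).filter (fun x => x ≡ v [ZMOD r])).card : ℝ) - ((b : ℝ) - a) / r| ≤ 1 := by
  have h := abs_card_Ico_filter_modEq_sub_le_rat hab hr v
  have hq : ((((Ico a b).filter (fun x => x ≡ v [ZMOD r])).card : ℝ) - ((b : ℝ) - a) / r) =
      (((((Ico a b).filter (fun x => x ≡ v [ZMOD r])).card : ℚ) - ((b : ℚ) - a) / r : ℚ) : ℝ) := by
    push_cast; rfl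
  rw [hq, ← Rat.cast_abs]
  exact_mod_cast h

/-! ### Euler products -/

/-- **`Π_p (1 - p⁻²) = 6/π²`** (`= ζ(2)⁻¹`; Mathlib's Euler product for the completely
multiplicative `n ↦ n⁻²` and `Σ n⁻² = π²/6`). [folklore] -/
theorem hasProd_one_sub_one_div_prime_sq :
    HasProd (fun p : Nat.Primes => (1 - 1 / ((p : ℕ) : ℝ) ^ 2)) (6 / Real.pi ^ 2) := by
  let F : ℕ →*₀ ℝ :=
    { toFun := fun n => ((n : ℝ) ^ 2)⁻¹
      map_zero' := by simp
      map_one' := by simp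
      map_mul' := fun m n => by push_cast; rw [mul_pow, mul_inv] }
  have hF : ∀ n : ℕ, F n = ((n : ℝ) ^ 2)⁻¹ := fun n => rfl
  have hsum : Summable (fun n : ℕ => ‖F n‖) := by
    simp only [hF, norm_inv, norm_pow, Real.norm_natCast]
    exact Real.summable_nat_pow_inv.mpr (by norm_num)
  have h := EulerProduct.eulerProduct_completely_multiplicative_hasProd hsum
  have htsum : ∑' n : ℕ, F n = Real.pi ^ 2 / 6 := by
    rw [← hasSum_zeta_two.tsum_eq]
    exact tsum_congr fun n => by simp [hF, one_div]
  rw [htsum] at h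
  have h' : HasProd (fun p : Nat.Primes => ((1 - F p)⁻¹)⁻¹) ((Real.pi ^ 2 / 6)⁻¹) := by
    unfold HasProd at h ⊢
    simpa only [Finset.prod_inv_distrib] using h.inv₀ (by positivity)
  rw [inv_div] at h'
  convert h' using 1
  ext p
  simp [hF, one_div]

/-- The local factor of `d ↦ 𝟙_{(d,L)=1} μ(d)/d²` at a prime `p`: `1 - 𝟙_{p ∤ L}/p²`. [folklore] -/
theorem tsum_moebius_coprime_div_sq_prime_pow {L : ℕ} (p : Nat.Primes) :
    ∑' e : ℕ, (if (((p : ℕ) ^ e).Coprime L) then (μ ((p : ℕ) ^ e) : ℝ) / (((p : ℕ) ^ e : ℕ) : ℝ) ^ 2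
      else 0) = 1 - if (p : ℕ).Coprime L then 1 / ((p : ℕ) : ℝ) ^ 2 else 0 := by
  have hp : (p : ℕ).Prime := p.2
  rw [tsum_eq_sum (s := {0, 1})]
  · rw [Finset.sum_pair (by norm_num)]
    simp only [pow_zero, Nat.coprime_one_left_eq_true, if_true, ArithmeticFunction.moebius_apply_one,
      Int.cast_one, Nat.cast_one, one_pow, div_one, pow_one,
      ArithmeticFunction.moebius_apply_prime hp, Int.cast_neg]
    split_ifs <;> ring
  · intro e he
    simp only [Finset.mem_insert, Finset.mem_singleton, not_or] at he
    have hμ : μ ((p : ℕ) ^ e) = 0 := by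
      rw [ArithmeticFunction.moebius_apply_prime_pow hp he.1, if_neg he.2]
    simp [hμ]

/-- `Π_p (1 - p⁻²) = 6/π²`, indexed by `ℕ` with the indicator of the primes. [folklore] -/
theorem hasProd_mulIndicator_one_sub_one_div_sq :
    HasProd ({p : ℕ | p.Prime}.mulIndicator fun n : ℕ => (1 - 1 / (n : ℝ) ^ 2)) (6 / Real.pi ^ 2) := by
  have h := hasProd_one_sub_one_div_prime_sq
  change HasProd ((fun n : ℕ => (1 - 1 / (n : ℝ) ^ 2)) ∘ Subtype.val (p := (· ∈ {x | Nat.Prime x}))) _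
    at h
  rwa [hasProd_subtype_iff_mulIndicator] at h

/-- **`Σ_{d ≥ 1, (d,L)=1} μ(d)/d² = (6/π²) Π_{p ∣ L} (1 - p⁻²)⁻¹`** for `L ≠ 0`: the Euler
product of the multiplicative function `d ↦ 𝟙_{(d,L)=1} μ(d) d⁻²` is `Π_{p ∤ L} (1 - p⁻²)`, and
`Π_p (1 - p⁻²) = 6/π²`. [folklore] -/
theorem hasSum_moebius_coprime_div_sq {L : ℕ} (hL : L ≠ 0) :
    HasSum (fun d : ℕ => if d.Coprime L then (μ d : ℝ) / (d : ℝ) ^ 2 else 0)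
      (6 / Real.pi ^ 2 * ∏ p ∈ L.primeFactors, (1 - 1 / (p : ℝ) ^ 2)⁻¹) := by
  set f : ℕ → ℝ := fun d => if d.Coprime L then (μ d : ℝ) / (d : ℝ) ^ 2 else 0 with hf
  have hf1 : f 1 = 1 := by simp [hf]
  have hf0 : f 0 = 0 := by simp [hf]
  have hmul : ∀ {m n : ℕ}, Nat.Coprime m n → f (m * n) = f m * f n := by
    intro m n hmn
    by_cases hm : m.Coprime L
    · by_cases hn : n.Coprime L
      · have hmn' : (m * n).Coprime L := Nat.coprime_mul_iff_left.2 ⟨hm, hn⟩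
        simp only [hf, if_pos hm, if_pos hn, if_pos hmn']
        rw [ArithmeticFunction.isMultiplicative_moebius.map_mul_of_coprime hmn]
        push_cast
        rw [div_mul_div_comm, mul_pow]
      · have h' : ¬ (m * n).Coprime L := fun h => hn (Nat.coprime_mul_iff_left.1 h).2
        simp only [hf, if_neg hn, if_neg h', mul_zero]
    · have h' : ¬ (m * n).Coprime L := fun h => hm (Nat.coprime_mul_iff_left.1 h).1
      simp only [hf, if_neg hm, if_neg h', zero_mul]
  have hbound : ∀ d : ℕ, ‖f d‖ ≤ 1 / (d : ℝ) ^ 2 := by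
    intro d
    simp only [hf]
    split_ifs
    · rw [norm_div, norm_pow, Real.norm_natCast]
      refine div_le_div_of_nonneg_right ?_ (by positivity)
      have := ArithmeticFunction.abs_moebius_le_one (n := d)
      rw [Real.norm_eq_abs, ← Int.cast_abs]
      exact_mod_cast this
    · rw [norm_zero]; positivity
  have hsum : Summable (fun d : ℕ => ‖f d‖) :=
    Summable.of_nonneg_of_le (fun _ => norm_nonneg _) hbound
      (Real.summable_one_div_nat_pow.mpr one_lt_two)
  -- Euler product of `f`, indexed by `ℕ` with the indicator of the primes
  have hA := EulerProduct.eulerProduct_hasProd_mulIndicator hf1 hmul hsum hf0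
  set gA : ℕ → ℝ := fun n => 1 - if n.Coprime L then 1 / (n : ℝ) ^ 2 else 0 with hgA
  have hfun : ({p : ℕ | p.Prime}.mulIndicator fun n : ℕ => ∑' e : ℕ, f (n ^ e)) =
      {p : ℕ | p.Prime}.mulIndicator gA := by
    ext n
    by_cases hn : n ∈ {p : ℕ | p.Prime}
    · rw [Set.mulIndicator_of_mem hn, Set.mulIndicator_of_mem hn, hgA]
      exact tsum_moebius_coprime_div_sq_prime_pow ⟨n, hn⟩
    · rw [Set.mulIndicator_of_notMem hn, Set.mulIndicator_of_notMem hn]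
  rw [hfun] at hA
  -- the finitely supported complementary factor
  set B : ℕ → ℝ := fun n => if n ∈ L.primeFactors then 1 - 1 / (n : ℝ) ^ 2 else 1 with hB
  have hBT : ∀ n ∉ L.primeFactors, B n = 1 := fun n hn => by rw [hB]; dsimp only; rw [if_neg hn]
  have hBprod : HasProd B (∏ n ∈ L.primeFactors, B n) := hasProd_prod_of_ne_finset_one hBT
  have hTprod : ∏ n ∈ L.primeFactors, B n = ∏ p ∈ L.primeFactors, (1 - 1 / (p : ℝ) ^ 2) :=
    Finset.prod_congr rfl fun n hn => by rw [hB]; dsimp only; rw [if_pos hn]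
  rw [hTprod] at hBprod
  -- product of the two
  have hAB := hA.mul hBprod
  have hABfun : (fun n : ℕ => {p : ℕ | p.Prime}.mulIndicator gA n * B n) =
      {p : ℕ | p.Prime}.mulIndicator fun n : ℕ => (1 - 1 / (n : ℝ) ^ 2) := by
    ext n
    by_cases hn : n ∈ {p : ℕ | p.Prime}
    · have hp : n.Prime := hn
      rw [Set.mulIndicator_of_mem hn, Set.mulIndicator_of_mem hn, hgA, hB]
      by_cases hd : n ∣ L
      · have hnc : ¬ n.Coprime L := by
          rw [hp.coprime_iff_not_dvd]; exact fun h => h hd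
        have hmem : n ∈ L.primeFactors := Nat.mem_primeFactors.2 ⟨hp, hd, hL⟩
        simp [hnc, hmem]
      · have hc : n.Coprime L := hp.coprime_iff_not_dvd.2 hd
        have hmem : n ∉ L.primeFactors := fun h => hd (Nat.dvd_of_mem_primeFactors h)
        simp [hc, hmem]
    · have hmem : n ∉ L.primeFactors := fun h => hn (Nat.prime_of_mem_primeFactors h)
      rw [Set.mulIndicator_of_notMem hn, Set.mulIndicator_of_notMem hn, hB]
      simp [hmem]
  rw [hABfun] at hAB
  have hval := hAB.unique hasProd_mulIndicator_one_sub_one_div_sq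
  -- solve for `∑' f`
  have hPpos : 0 < ∏ p ∈ L.primeFactors, (1 - 1 / (p : ℝ) ^ 2) := by
    refine Finset.prod_pos fun p hp => ?_
    have hp2 : (2 : ℝ) ≤ p := by exact_mod_cast (Nat.prime_of_mem_primeFactors hp).two_le
    have : 1 / (p : ℝ) ^ 2 ≤ 1 / 4 := one_div_le_one_div_of_le (by norm_num) (by nlinarith)
    linarith
  have htsum : ∑' n, f n = 6 / Real.pi ^ 2 * ∏ p ∈ L.primeFactors, (1 - 1 / (p : ℝ) ^ 2)⁻¹ := by
    rw [Finset.prod_inv_distrib, ← div_eq_mul_inv, eq_div_iff hPpos.ne', hval]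
  rw [← htsum]
  exact hsum.of_norm.hasSum

end Literature.NumberTheory.QuadraticFields

end
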